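import Mathlib
import HarnessLib

/-!
# Barrier: blow-up for the exogenously truncated dyadic Navier–Stokes model (Tao 2016, Prop. 5.1)

Barrier catalogue `Literature/Barriers/NavierStokesRegularity/` (D-0021), entry for
`NavierStokesRegularity/NavierStokesRegularity`; a companion of `TaoAveragedBlowup` (Tao 2016,
Thm. 1.5) recording the paper's simplest blow-up mechanism as a fully explicit statement about a
countable ODE system — the form in which the "supercriticality" blow-up is easiest to attack
formally.

## What the source prints (T. Tao, JAMS 29 (2016); held arXiv text)

* §1.2 p. 10: "One rather drastic (and not particularly satisfactory) way to [fix the interference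
  problem] is to forcibly (i.e., exogenously) shut off most of the nonlinear interactions, so that
  only one pair `Xₙ, X_{n+1}` of adjacent modes experiences a nonlinear (but energy-conserving)
  interaction at any given time. Specifically, one can consider a truncated-nonlinearity ODE
  `∂ₜXₙ = -λ^{2nα}Xₙ + 1_{n-1 = n(t)} λ^{n-1}X_{n-1}² - 1_{n = n(t)} λⁿXₙX_{n+1}` where
  `n : [0,T_*) → ℤ` is a piecewise constant function that one specifies in advance … It is not
  difficult to construct a blowup solution for this truncated ODE; we do so in Section 5. Such a
  result corresponds to a weak version of Theorem 1.5 in which the averaged nonlinearity `B̃` is now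
  allowed to be time dependent, `B̃ = B̃(t)`, with the dependence of `B̃(t)` on `t` being piecewise
  constant (and experiencing an unbounded number of discontinuities as `t` approaches `T_*`)";
  footnote: "It is worth noting, however, that a surprisingly large portion of the local theory for
  Navier–Stokes would survive with a time-dependent nonlinearity, even if it were discontinuous in
  time, so even this weakened version of Theorem 1.5 provides a somewhat non-trivial barrier that
  can still exclude certain solution strategies to the Navier–Stokes regularity problem."
* §5.2, **Proposition 5.1** (Blowup for a truncated dyadic model), p. 26: "Let `λ > 1` and
  `0 < α < 1/2`, and let `0 < δ < 1-2α`. Then there exists a natural number `n₀`, a sequence of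
  times `0 = t_{n₀} < t_{n₀+1} < t_{n₀+2} < …` increasing to a finite limit `T_*`, and continuous,
  piecewise smooth functions `Xₙ : [0,T_*) → ℝ` for `n ≥ n₀` such that `X_{n₀+k}(t) = 0` whenever
  `k ≥ 1` and `0 ≤ t ≤ t_{n₀+k-1}`, and such that
  `∂ₜXₙ = -λ^{2nα}Xₙ + 1_{(t_{n-1},t_n)}(t) λ^{n-1}X_{n-1}² - 1_{(t_n,t_{n+1})}(t) λⁿXₙX_{n+1}`
  for all `t ∈ [0,T_*)` other than the times `t_{n₀}, t_{n₀+1}, …`, and all `n ≥ n₀`, with the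
  convention that `t_{n₀-1} = 0` and `X_{n₀-1} = 0`. Furthermore, we have
  `X_{n₀+k}(t_{n₀+k}) = λ^{-δk}` for every `k ≥ 0`. In particular, for any `δ' > δ`, we have the
  blowup `limsup_{t → T_*} sup_n λ^{δ'n}|Xₙ(t)| = +∞`." Followed by: "Note that the blowup here is
  available for all values of the dissipation parameter up to the critical value of `1/2`, in
  contrast to the results in [katz-dyadic] and [ches] for the untruncated equation which cover the
  ranges `α < 1/4` and `α < 1/3` respectively, as well as the results in [bmr] establishing global
  solutions when `λ = 2` and `2/5 ≤ α ≤ 1/2`"; the proof (pump gate with dissipation,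
  `∂ₜx = -εx - xy`, `∂ₜy = -λ^{-2α}εy + x²`, perturbing the explicit `ε = 0` solution) occupies
  p. 26; "one can use (a slight modification of) this proposition to obtain a weaker 'exogenous'
  version of Theorem 1.5 … We leave the details (which are an adaptation of those in Section 3) to
  the interested reader."

## Formal content

Namespace `Literature.Barriers.NavierStokesRegularity.TruncatedDyadic`: the right-hand side
`truncRHS` of the truncated ODE (modes re-indexed by `k = n - n₀ ∈ ℕ`, switching times
`t : ℕ → ℝ`), and the named fact `Tao2016_prop51` (Prop. 5.1 as printed; not proved here — an
elementary but genuine ODE construction, a natural `provefact` target). Catalogue entry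
`TruncatedDyadicBlowup := Tao2016_prop51`.

## Audit (barrier audit, 2026-08-14; docstring-only sharpening, declarations unchanged)

* Formal status. The named fact is PROVED in the tree: `TruncatedDyadic.Tao2016_prop51_holds` and
  `TruncatedDyadicBlowup_holds` in the sibling file `TruncatedDyadicBlowupProofs.lean`
  (Picard–Lindelöf for the clamped pump-gate field, Grönwall comparison with the explicit
  `(sech, tanh)` solution, geometric summation of the step lengths; axioms `propext`,
  `Classical.choice`, `Quot.sound`). The ODE-level barrier is machine-checked; the audit concerns
  the metadata of the structured block only.
* Logical position. The class blocked here is, by its own description, the autonomy-free part of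
  the class blocked by `TaoAveragedBlowup` (Thm. 1.5, proved in print); more generally, a strategy
  that would apply verbatim to EVERY piecewise-constant family `B̃(t)` of averaged Euler operators
  with the cancellation property applies in particular to constant families, where Thm. 1.5
  already refutes it. So the `blocks:` conclusion holds a fortiori from Thm. 1.5, and this entry
  never bites where `TaoAveragedBlowup` does not; its independent content is the explicit,
  elementary (now formal) supercritical cascade mechanism for every `α < 1/2`.
  [cite: Tao2016AveragedNS, §1.1 p. 8 and §1.2 p. 10]
* The PDE transfer ("exogenous Theorem 1.5") is sketched, not printed, and is not a corollary of
  Prop. 5.1: (a) the single-scale pieces `1_{(tₙ,tₙ₊₁)}(t)·Cₙ` are not local cascade operators in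
  the sense of Def. 3.1 (a basic local cascade operator sums one interaction pattern over ALL
  scales `n ∈ ℤ`), so Thm. 3.2 has to be re-run with scale-localising order-`0` multipliers
  (available for the §4 choice of `ψᵢ`, whose dilated frequency balls are pairwise disjoint);
  (b) the §4 reduction is inexact — "It is unfortunate that the `ψ_{i,n}` are not eigenfunctions
  of the Laplacian `Δ`, otherwise … the equation (system) would collapse to a system of ODE";
  Lemma 4.1 (iii)–(iv) carry `O((1+ε₀)^{2n} E_{i,n}^{1/2})` errors and an energy defect — so a
  stability analysis of the pump chain under these errors (a light analogue of §6) is also needed.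
  [cite: Tao2016AveragedNS, §3 Def. 3.1 and Thm. 3.2 (p. 14)] [cite: Tao2016AveragedNS, §4 Lemma 4.1 (pp. 21–22)] [cite: Tao2016AveragedNS, §5.2 p. 26 (after the proof)]
* Normalisation of the contrast clause. Tao's remark after Prop. 5.1, "[bmr] establishing global
  solutions when `λ = 2` and `2/5 ≤ α ≤ 1/2`", is in BMR's normalisation (`λₙ = λⁿ`, `λ = 2`,
  strength `λₙ^β`, `β ∈ (2, 5/2]`, data `xₙ ≥ 0` with `∑ xₙ² < ∞`); in the normalisation of THIS
  file (strength `λⁿ`, dissipation `λ^{2nα}`, BMR's viscosity `ν` scaled out) BMR's Theorem 1 is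
  the case `λ = 2^β = 2^{1/α}`, `α = 1/β ∈ [2/5, 1/2)`, non-negative data — as Tao states on p. 9: "for the values
  `λ = 2^{1/α}`, `α = 2/5`, global regularity was established in [bmr] (for non-negative initial
  data `Xₙ(0)`) … the argument in [bmr] is sensitive to the specific numerical value of `λ` (and
  also relies heavily on the assumption of initial non-negativity)". In particular nothing in
  print covers the untruncated model at this file's `λ = 2`, `α = 2/5` (BMR's `λ = 2^{2/5}`).
  [cite: BarbatoMorandinRomito2011, §1.1 (1.1) and Thm. 1] [cite: Tao2016AveragedNS, §1.2 p. 9]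
* Literature since 2016 (`lit search`, `lit citing arxiv:1402.0290`, held texts). The untruncated
  scalar picture quoted under `because:` is current: blow-up for `γ < 1/3`, regularity for
  `γ ≥ 2/5`, "We also note the presence of the gap `1/3 ≤ γ < 1/2` … The gap was made smaller
  thanks to a regularity result of Barbato, Morandin and Romito … `γ ≥ 2/5`"
  [cite: CheskidovDaiFriedlander2023, §3.2.1]; Tao's four-mode circuit "is the only known model
  that exhibits finite-time blow-up with viscosity in dimension three" without forcing, while a
  FORCED Obukhov-type shell model with super-exponentially separated shells `N_k = N₀^{b^k}` blows
  up from `𝒞^∞` data for every `α > 2` in that paper's intermittency normalisation ("The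
  inclusion of an external force is necessary for blow-up in this model") — a second exogenously
  assisted supercritical blow-up, consistent with this entry [cite: Palasek2026ElementaryModel, §1.1, Thm. 1.3 and Rem. 1.4–1.5];
  transport noise delays the blow-up of Tao's averaged equation with high probability
  (regularisation by noise; not a deterministic regularity technique) [cite: Lange2023, §3.3].
  No printed result contradicts Prop. 5.1 or proves regularity for a time-dependent averaged
  family `B̃(t)`; no evasion specific to this entry (i.e. using autonomy but not the finer
  structure of `B`) survives `TaoAveragedBlowup`.
* Type II. Taking `δ < δ' < 1 - 2α` in the fact shows that the scaling-critical weighted amplitude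
  `sup_k λ^{(1-2α)(n₀+k)}|X_k|` (the `Ḃ^{1/2}_{2,∞}` level at `α = 2/5`, via `λⁿ ↔ N^{5/2}`) is
  unbounded near `T_*` — `TruncatedDyadicBlowup.critical_blowup` below — matching Tao's remark
  that the blow-up of Thm. 1.5 is of Type II; Type-I exclusion arguments are not in tension with
  this entry. [cite: Tao2016AveragedNS, §1.1 footnote p. 8] [cite: Tao2016AveragedNS, §1.2 (utx) p. 9]
* … but Type I at the endpoint (second audit pass, refuter; facet in the sibling Proofs file). The
  printed hypothesis `δ < 1 - 2α` enters Tao's proof (and the Lean proof) only through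
  `2α - 1 + δ ≤ 0`: the rescaled dissipations are `ε_k = λ^{-(1-2α)n₀-(1-2α-δ)k}`, and at
  `δ = 1 - 2α` they are constant, `λ^{-(1-2α)n₀}`, still "sufficiently small" for `n₀` large. Run
  at this endpoint — the critical decay exponent — the same pump chain has
  `X_{n₀+k}(t_{n₀+k}) = λ^{-(1-2α)k}` and, by the pump-gate energy bound `U² + V² ≤ 1`, a BOUNDED
  scaling-critical weighted amplitude `sup_{k,s} λ^{(1-2α)(n₀+k)}|X_k(s)| ≤ λ^{(1-2α)(n₀+1)}`
  while every weight `δ' > 1 - 2α` blows up: a blow-up at the Type I (scale-invariant) RATE; and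
  since `ε_k` is constant in `k`, one pump-gate solution can serve every step, which makes the
  witness EXACTLY discretely self-similar from the second mode on,
  `X_{k+1}(t_{k+1}+σ) = λ^{-(1-2α)}X_k(t_k+λ^{2α}σ)` (`k ≥ 1`, all `σ`). Machine-checked in
  `TruncatedDyadicBlowupProofs.lean` (`TruncatedDyadic.Tao2016_prop51_of_le` for `0 < δ ≤ 1 - 2α`,
  `TruncatedDyadic.Tao2016_prop51_typeI`, `TruncatedDyadic.exists_stepData_const`, `StepData.dss`,
  `TruncatedDyadic.Tao2016_prop51_dss`; catalogue facet `TruncatedDyadicTypeIBlowup` with its own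
  structured block). So the sentence "Type-I exclusion arguments are not in tension with this
  entry" is true of the entry AS STATED (`δ < 1 - 2α`) but not of the mechanism: inside the
  technique class (time-insensitive abstract energy/estimates arguments) exclusions of Type-I-rate
  — even exactly discretely self-similar — forward singularities and `ℓ^∞`-in-scale critical
  regularity criteria are blocked as well (see the facet's `blocks:`/`evasions_known:`). NOT shown:
  that Liouville theorems for critically bounded ANCIENT solutions fail in the class — no ancient
  witness is constructed (plausible separate item: with `ε_k` constant the chain should extend to
  all `k ∈ ℤ`, with infinite energy in the low modes), and the bridge "Liouville ⇒ no Type I" runs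
  through a rescaling/compactness step with an autonomous limit equation, which the exogenous
  model may evade anyway. In the §1.2 dictionary the witness's `ℓ^q`-type critical norms with
  `q < ∞`, the analogues of `L³`, still diverge, like `k^{1/q}`, so ESS-type `L³` criteria are not
  formally addressed even at the endpoint. [cite: Tao2016AveragedNS, §5.2 proof of Prop. 5.1 (p. 26)] [cite: Tao2016AveragedNS, §1.1 footnote p. 8]
* Sharpness on the dissipation axis (second audit pass). The technique class is NOT powerless
  near criticality: for the critical-hyperdissipative dyadic model with dissipation weakened by a
  factor `1/gₙ`, `∑ₙ gₙ⁻¹ = ∞` (logarithmic supercriticality), Barbato–Morandin–Romito prove global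
  regularity by a bounding-sequence energy argument (their Thm. 5: `gₙ` non-decreasing, `kₙ/gₙ`
  eventually non-decreasing, `∑ gₙ⁻¹ = ∞`), and §3.3.1 extends it to uniformly bounded and
  uniformly Lipschitz (in `X`) time-dependent couplings `φₙ = φₙ(t, X_{n-m}, …, X_{n+m})`, the
  Lipschitz condition serving local existence/uniqueness only — "In Proposition … and Lemma 7 we
  only use the uniform boundedness" — i.e. to a class containing the exogenously truncated model
  (`φₙ(t) ∈ {0, 1}` is `X`-independent, so it qualifies); the PDE analogue (hyperdissipative
  Navier–Stokes and generalized Leray-α systems) "confirm[s] that the condition … is optimal, when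
  general non-linear terms with the same scaling are considered", with explicit reference to Tao's
  Remark 5.2. Normalisations: BMR's condition reads `∫₁^∞ ds/(s g_BMR(s)) = ∞` with
  `g_BMR = G²`, their dissipation symbol being `|k|^{(d+2)/4}/G` squared, while Tao's Remark 5.2
  has dissipation `λⁿ/g(λⁿ)²` and exogenous blow-up (modified pump nonlinearity) for
  `∫₁^∞ ds/(s g(s)²) < ∞`; with `g_BMR = g²` the two conditions are exact complements. Prop. 5.1
  (`gₙ = λ^{(1-2α)n}`, summable) lies strictly inside the blow-up regime; the barrier's content is
  exactly "power-supercritical", no more. [cite: BarbatoMorandinRomito2014Dyadic, §1.1, Thm. 5 and §3.3.1] [cite: BarbatoMorandinRomito2014, Thms. 1.1–1.2 and the remark after Thm. 1.2] [cite: Tao2016AveragedNS, §5.2 Rem. 5.2 and footnote p. 27]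
* Printed slip (p. 26, proof of Prop. 5.1): the rescaled receiving equation is printed as
  `∂ₜy = -λ^{-2α}εy + x²`; the dissipation of the receiving mode `X_{n₀+k+1}` rescales to
  `λ^{+2α}ε` (as in the Lean proof, `ε' = λ^{2α}ε ≤ η`). Immaterial to the statement.
  [cite: Tao2016AveragedNS, §5.2 proof of Prop. 5.1 (p. 26)]

## References

* T. Tao, *Finite time blowup for an averaged three-dimensional Navier–Stokes equation*, J. Amer.
  Math. Soc. 29 (2016), 601–674; arXiv:1402.0290, §1.1 p. 8, §1.2 pp. 9–10, §3 Def. 3.1,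
  Thm. 3.2, §4 Lemma 4.1, §5.2 Prop. 5.1. [`Tao2016AveragedNS`]
* A. Cheskidov, Trans. Amer. Math. Soc. 360 (2008), Thm. 5.3. [`Cheskidov2008`]
* D. Barbato, F. Morandin, M. Romito, Nonlinearity 24 (2011), §1.1 (1.1), Thm. 1, Lemma 2.1.
  [`BarbatoMorandinRomito2011`]
* A. Cheskidov, M. Dai, S. Friedlander, *Dyadic models for fluid equations: a survey*, J. Math.
  Fluid Mech. 25 (2023), Paper 62; arXiv:2209.10203, §3.2.1, §3.4. [`CheskidovDaiFriedlander2023`]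
* S. Palasek, *Finite-time blow-up in an elementary model of the 3D Navier–Stokes equations*,
  arXiv:2605.13827 (2026), §1.1, Thm. 1.3, Rem. 1.4–1.5, §4. [`Palasek2026ElementaryModel`]
* T. Lange, *Regularization by noise of an averaged version of the Navier–Stokes equations*,
  J. Dynam. Differential Equations 36 (2023), 3011–3036; arXiv:2205.14941, §3.3. [`Lange2023`]
* D. Barbato, F. Morandin, M. Romito, *Global regularity for a logarithmically supercritical
  hyperdissipative dyadic equation*, Dyn. Partial Differ. Equ. 11 (2014), 39–52; arXiv:1403.2852,
  §1.1, Thm. 5, §3.3.1. [`BarbatoMorandinRomito2014Dyadic`]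
* D. Barbato, F. Morandin, M. Romito, *Global regularity for a slightly supercritical
  hyperdissipative Navier–Stokes system*, Anal. PDE 7 (2014), 2009–2027; arXiv:1407.6734,
  Thms. 1.1–1.2 and the remark after Thm. 1.2. [`BarbatoMorandinRomito2014`]
-/

noncomputable section

open Set Filter Topology

namespace Literature.Barriers.NavierStokesRegularity

namespace TruncatedDyadic

/-- The switching time attached to the re-indexed mode `k = n - n₀` shifted by `-1`: the printed
convention `t_{n₀-1} = 0` (so that the first mode receives no input). [cite: Tao2016AveragedNS, §5.2 Prop. 5.1] -/
def prevTime (t : ℕ → ℝ) (k : ℕ) : ℝ :=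
  if k = 0 then 0 else t (k - 1)

/-- The re-indexed amplitude `X_{n₀ + k - 1}`, with the printed convention `X_{n₀-1} = 0`.
[cite: Tao2016AveragedNS, §5.2 Prop. 5.1] -/
def prevMode (X : ℕ → ℝ → ℝ) (k : ℕ) : ℝ → ℝ :=
  if k = 0 then 0 else X (k - 1)

/-- The right-hand side of the exogenously truncated dyadic system of Prop. 5.1 at the mode
`n = n₀ + k` and time `s`:
`-λ^{2nα} Xₙ(s) + 1_{(t_{n-1}, t_n)}(s) λ^{n-1} X_{n-1}(s)² - 1_{(t_n, t_{n+1})}(s) λⁿ Xₙ(s) X_{n+1}(s)`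
(real powers of `λ > 1`; `t k` is the printed `t_{n₀+k}`). [cite: Tao2016AveragedNS, §5.2 Prop. 5.1 (the displayed ODE)] -/
def truncRHS (lam α : ℝ) (n₀ : ℕ) (t : ℕ → ℝ) (X : ℕ → ℝ → ℝ) (k : ℕ) (s : ℝ) : ℝ :=
  -lam ^ (2 * ((n₀ + k : ℕ) : ℝ) * α) * X k s +
    (Ioo (prevTime t k) (t k)).indicator (fun _ => (1 : ℝ)) s *
      lam ^ (((n₀ + k : ℕ) : ℝ) - 1) * prevMode X k s ^ 2 -
    (Ioo (t k) (t (k + 1))).indicator (fun _ => (1 : ℝ)) s *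
      lam ^ ((n₀ + k : ℕ) : ℝ) * X k s * X (k + 1) s

/-- **Tao 2016, Proposition 5.1 (Blowup for a truncated dyadic model)**, as printed, with the
modes re-indexed by `k = n - n₀` (`X k` is the printed `X_{n₀+k}`, `t k` the printed `t_{n₀+k}`):
for `λ > 1`, `0 < α < 1/2`, `0 < δ < 1 - 2α` there are `n₀`, strictly increasing times
`0 = t 0 < t 1 < …` converging to a finite `T_*` (all `< T_*`), and functions `X k`, continuous on
`[0, T_*)`, with `X k s = 0` for `k ≥ 1` and `0 ≤ s ≤ t (k-1)`, solving the truncated ODE at every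
`s ∈ [0, T_*)` that is not a switching time, with `X k (t k) = λ^{-δk}` for every `k`, and hence,
for every `δ' > δ`, `limsup_{s → T_*} sup_k λ^{δ'(n₀+k)}|X k s| = +∞` (rendered: the weighted
amplitudes are unbounded on every final interval `(s₀, T_*)`). "Piecewise smooth" is rendered as
differentiability (with the prescribed derivative) off the switching times. Named fact, not proved
here. [cite: Tao2016AveragedNS, §5.2 Prop. 5.1] -/
def Tao2016_prop51 : Prop :=
  ∀ lam α δ : ℝ, 1 < lam → 0 < α → α < 1 / 2 → 0 < δ → δ < 1 - 2 * α →
    ∃ (n₀ : ℕ) (t : ℕ → ℝ) (Tstar : ℝ) (X : ℕ → ℝ → ℝ),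
      t 0 = 0 ∧ StrictMono t ∧ (∀ k, t k < Tstar) ∧ Tendsto t atTop (𝓝 Tstar) ∧
      (∀ k, ContinuousOn (X k) (Ico 0 Tstar)) ∧
      (∀ k, 1 ≤ k → ∀ s, 0 ≤ s → s ≤ t (k - 1) → X k s = 0) ∧
      (∀ k, ∀ s ∈ Ico 0 Tstar, s ∉ range t →
        HasDerivAt (X k) (truncRHS lam α n₀ t X k s) s) ∧
      (∀ k : ℕ, X k (t k) = lam ^ (-(δ * k))) ∧
      ∀ δ' : ℝ, δ < δ' → ∀ M s₀ : ℝ, s₀ < Tstar →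
        ∃ s ∈ Ioo s₀ Tstar, ∃ k : ℕ, M < lam ^ (δ' * ((n₀ + k : ℕ) : ℝ)) * |X k s|

end TruncatedDyadic

/-- **Barrier (Tao 2016, Prop. 5.1): the exogenously truncated dyadic cascade blows up for every
supercritical dissipation `α < 1/2`.** Definitionally the named fact
`TruncatedDyadic.Tao2016_prop51` (the proposition as printed, modes re-indexed; not proved here).
Tao: "Such a result corresponds to a weak version of Theorem 1.5 in which the averaged nonlinearity
`B̃` is now allowed to be time dependent, `B̃ = B̃(t)`, … piecewise constant".
[cite: Tao2016AveragedNS, §5.2 Prop. 5.1] [cite: Tao2016AveragedNS, §1.2 p. 10]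

BARRIER (structured block, D-0021):
- technique_class: energy-identity, energy-methods, function-space-estimates, harmonic-analysis, time-dependent-nonlinearity-insensitive, exogenously-truncated-dyadic-model — energy-identity-plus-estimates arguments that are moreover insensitive to TIME-DEPENDENCE of the (averaged) nonlinearity — the part of the abstract class of `TaoAveragedBlowup` ("any strategy that fails to distinguish between the Euler bilinear operator `B` and its averaged counterparts `B̃`") that never uses the autonomy of the equation: "a surprisingly large portion of the local theory for Navier–Stokes would survive with a time-dependent nonlinearity, even if it were discontinuous in time" [cite: Tao2016AveragedNS, §1.2 p. 10 and footnote]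
- blocks: NavierStokesRegularity in Tao's mild form (his Conj. 1.2 ⇔ Conj. 1.1 = Clay-type `Literature.NS.NavierStokesExistenceSmoothR3` for Schwartz data, Lemma 1.3) by such arguments, through "a weak version of Theorem 1.5" with `B̃ = B̃(t)` piecewise constant in time [cite: Tao2016AveragedNS, §1.2 p. 10 and §1.1 Lemma 1.3]
- because: Prop. 5.1 — with only one adjacent pair of modes interacting at a time (switching times `t_{n₀+k}` fixed in advance), the "pump gate with dissipation" transfers a fixed fraction `λ^{-δ}` of amplitude to the next mode in time `≲ λ^{-n₀-k+δk}`, the times sum to a finite `T_*` and `sup_n λ^{δ'n}|Xₙ|` diverges; this works for every `α < 1/2`, i.e. "for all values of the dissipation parameter up to the critical value of `1/2`", unlike the untruncated scalar model, for which the known results "cover the ranges `α < 1/4` and `α < 1/3` respectively" (blow-up) and give "global solutions when `λ = 2` and `2/5 ≤ α ≤ 1/2`" [cite: Tao2016AveragedNS, §5.2 Prop. 5.1 and proof p. 26] [cite: Cheskidov2008, §5 Thm. 5.3] [cite: BarbatoMorandinRomito2011, §1.1 Thm. 1]; the last clause is in BMR's normalisation — in this file's normalisation it reads `λ = 2^{1/α}`,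 `α ∈ [2/5, 1/2)`, non-negative `ℓ²` data (Audit section of the module docstring) [cite: Tao2016AveragedNS, §1.2 p. 9]
- evasions_known: use the autonomy of the true equation — for the unmodified scalar dyadic model at three-dimensional scaling the interference between consecutive transfers prevents this blow-up (catalogue entry `DyadicCascadeRegularity`) [cite: BarbatoMorandinRomito2011, §1.1 Thm. 1] [cite: Tao2016AveragedNS, §1.2 p. 9]; all evasions recorded under `TaoAveragedBlowup` (finer structure of the nonlinearity: backward uniqueness, slowly varying data) apply a fortiori [cite: Tao2016AveragedNS, §1.1 p. 8]; note that Tao's full Theorem 1.5 removes the time-dependence altogether (endogenous "quadratic circuits") [cite: Tao2016AveragedNS, §1.2 p. 10 and §6 Thm. 6.2]; since the blocked class is a subclass of that of `TaoAveragedBlowup`, an evasion of this entry that does not use the finer structure of `B` still faces Thm. 1.5 — the autonomy-based mechanisms on record live at the dyadic level: BMR's invariant region for `(Yₙ, Yₙ₊₁)` (non-negative data, BMR's `λ = 2`) [cite: BarbatoMorandinRomito2011, §2 Lemma 2.1] and the "high frequencies dissipating away before a cascade has time to arrive" regularity of the unforced viscous Obukhov model reported in [cite: Palasek2026ElementaryModel,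 §1.1 and Rem. 1.4]; the blow-up here is Type II (`TruncatedDyadicBlowup.critical_blowup`), so Type-I exclusions do not address THIS ENTRY (`δ < 1 - 2α`) [cite: Tao2016AveragedNS, §1.1 footnote p. 8] — but the same construction at the endpoint `δ = 1 - 2α` blows up at the Type I rate, with bounded `ℓ^∞`-in-scale critical amplitude and, with identical steps, exact discrete self-similarity from the second mode on (facet `TruncatedDyadicTypeIBlowup` and `TruncatedDyadic.Tao2016_prop51_dss` in the sibling Proofs file, machine-checked), so exclusions of Type-I-rate (even exactly discretely self-similar) forward singularities and `ℓ^∞`-in-scale critical regularity criteria carried out inside the technique class are NOT evasions of the mechanism (Liouville theorems for critically bounded ancient solutions: not addressed — no ancient witness is constructed); NOT an evasion either: the bounding-sequence / cumulative-dissipation energy argument of Barbato–Morandin–Romito, which is blind to bounded (Lipschitz-in-`X`) time-dependent couplings and succeeds exactly for logarithmically weakened critical dissipation `∑ gₙ⁻¹ = ∞` (their monotonicity conditions on `gₙ`, `kₙ/gₙ`), not in the power-supercritical regime [cite: BarbatoMorandinRomito2014Dyadic, Thm. 5 and §3.3.1]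
- scope_caveats: (i) what is proved in print is the ODE statement Prop. 5.1; the passage to the "exogenous" PDE version of Thm. 1.5 with a time-dependent averaged operator `B̃(t)` is only sketched ("We leave the details … to the interested reader") [cite: Tao2016AveragedNS, §5.2 p. 26 (after the proof)] — and it is not a corollary: single-scale pieces are not Def. 3.1 local cascade operators and the §4 reduction to the ODE is inexact (Lemma 4.1 (iii)–(iv)), see the Audit section [cite: Tao2016AveragedNS, §3 Def. 3.1 and Thm. 3.2 (p. 14)] [cite: Tao2016AveragedNS, §4 Lemma 4.1 (pp. 21–22)]; (ii) the blow-up is in the weighted sup `sup_n λ^{δ'n}|Xₙ|` for `δ' > δ` (the energy `∑Xₙ²` decays), i.e. a loss of high-index decay, for ONE constructed initial configuration (`X_{n₀} = 1`, other modes `0`) and large `n₀` [cite: Tao2016AveragedNS, §5.2 Prop. 5.1 and proof]; (iii) Tao himself calls the truncation "rather drastic (and not particularly satisfactory)" and the resulting barrier "somewhat non-trivial" [cite: Tao2016AveragedNS, §1.2 p. 10]; (iv) the Lean statement re-indexes modes by `k = n - n₀` and renders "piecewise smooth" as differentiability off the switching times and the `limsup = +∞` as unboundedness on every final time interval; named fact,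 proved in the sibling file `TruncatedDyadicBlowupProofs.lean` (`TruncatedDyadicBlowup_holds`); (v) the blocked class is a subclass of that of `TaoAveragedBlowup`, so this entry adds no blocking power beyond Thm. 1.5 [cite: Tao2016AveragedNS, §1.1 p. 8 and §1.2 p. 10]; (vi) the contrast with the untruncated scalar model is `λ`- and sign-specific — BMR's regularity is for their `λ = 2` (here `λ = 2^{1/α}`) and non-negative data, nothing in print covers this file's `λ = 2`, `α = 2/5`, and the range `1/3 ≤ γ < 2/5` of the untruncated model is open as of 2023 [cite: BarbatoMorandinRomito2011, §1.1 Thm. 1] [cite: CheskidovDaiFriedlander2023, §3.2.1]; (vii) the blow-up is Type II (the scaling-critical weighted amplitude diverges, `TruncatedDyadicBlowup.critical_blowup`) while the energy `∑ Xₖ²` decays [cite: Tao2016AveragedNS, §1.1 footnote p. 8]; the printed restriction `δ < 1 - 2α` is inessential (`TruncatedDyadic.Tao2016_prop51_of_le`, `0 < δ ≤ 1 - 2α`) and the endpoint witness blows up at the Type I rate (bounded `ℓ^∞`-in-scale critical amplitude; exactly discretely self-similar from the second mode on when the steps are taken identical) — recorded as the separate facet `TruncatedDyadicTypeIBlowup`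 with `TruncatedDyadic.Tao2016_prop51_typeI` / `Tao2016_prop51_dss` (sibling Proofs file; not in print); (viii) sharp on the dissipation axis and no sharper: with critical dissipation weakened by `1/gₙ` (`gₙ` non-decreasing, `kₙ/gₙ` eventually non-decreasing, `∑ gₙ⁻¹ = ∞`) the truncated model — indeed any uniformly bounded, Lipschitz-in-`X` time-dependent nearest-neighbour coupling `φₙ(t, X)` — is globally regular by an argument inside the technique class [cite: BarbatoMorandinRomito2014Dyadic, Thm. 5 and §3.3.1] [cite: BarbatoMorandinRomito2014, Thms. 1.1–1.2 and the remark after Thm. 1.2], complementing Tao's exogenous blow-up for `∫₁^∞ ds/(s g(s)²) < ∞` (Tao's `g²` = BMR's `g`) [cite: Tao2016AveragedNS, §5.2 Rem. 5.2 and footnote p. 27]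
- status: established — theorem (Prop. 5.1 proved in print and in the tree as `TruncatedDyadicBlowup_holds`); the PDE-level "exogenous Theorem 1.5" is sketched only (caveat (i)), its blocking conclusion holding a fortiori via `TaoAveragedBlowup` -/
def TruncatedDyadicBlowup : Prop :=
  TruncatedDyadic.Tao2016_prop51

/-- The catalogue entry is Tao's Prop. 5.1, by definition. [cite: Tao2016AveragedNS, §5.2 Prop. 5.1] -/
theorem truncatedDyadicBlowup_iff : TruncatedDyadicBlowup ↔ TruncatedDyadic.Tao2016_prop51 :=
  Iff.rfl

/-- Consequence: at the three-dimensional Navier–Stokes value `α = 2/5` of the dissipation degree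
(where non-negative `ℓ²` solutions of the untruncated scalar model are globally regular in BMR's
normalisation `λₙ = 2ⁿ`, strength `λₙ^{5/2}`, i.e. `λ = 2^{5/2}` in the normalisation of this
file) the truncated model blows up for every `λ > 1` and every `δ ∈ (0, 1/5)`.
[cite: Tao2016AveragedNS, §5.2 Prop. 5.1 and the remark after it] [cite: Tao2016AveragedNS, §1.2 p. 9]
[cite: BarbatoMorandinRomito2011, §1.1 Thm. 1] -/
theorem TruncatedDyadicBlowup.at_two_fifths (h : TruncatedDyadicBlowup) {lam δ : ℝ} (hlam : 1 < lam)
    (hδ : 0 < δ) (hδ' : δ < 1 / 5) :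
    ∃ (n₀ : ℕ) (t : ℕ → ℝ) (Tstar : ℝ) (X : ℕ → ℝ → ℝ),
      t 0 = 0 ∧ StrictMono t ∧ (∀ k, t k < Tstar) ∧ Tendsto t atTop (𝓝 Tstar) ∧
      (∀ k : ℕ, X k (t k) = lam ^ (-(δ * k))) ∧
      ∀ δ' : ℝ, δ < δ' → ∀ M s₀ : ℝ, s₀ < Tstar →
        ∃ s ∈ Ioo s₀ Tstar, ∃ k : ℕ, M < lam ^ (δ' * ((n₀ + k : ℕ) : ℝ)) * |X k s| := by
  obtain ⟨n₀, t, Tstar, X, h0, hmono, hlt, hlim, -, -, -, hval, hblow⟩ :=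
    h lam (2 / 5) δ hlam (by norm_num) (by norm_num) hδ (by linarith)
  exact ⟨n₀, t, Tstar, X, h0, hmono, hlt, hlim, hval, hblow⟩

/-- **Type II reading of Prop. 5.1** (audit corollary): for every `λ > 1` and every supercritical
`0 < α < 1/2` the truncated system has a solution (in the sense of the fact: continuous on
`[0, T_*)`, solving the truncated ODE off the switching times) whose SCALING-CRITICAL weighted
amplitude `sup_k λ^{(1-2α)(n₀+k)}|X_k(s)|` — the critical profile being `Xₙ ~ λ^{(2α-1)n}`,
i.e. the `Ḃ^{1/2}_{2,∞}` level at `α = 2/5` under `λⁿ ↔ N^{5/2}` — is unbounded on every final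
interval `(s₀, T_*)`. Obtained from the fact with `δ = (1-2α)/2 < δ' = 3(1-2α)/4 ≤ 1-2α` and
`λ^{δ'(n₀+k)} ≤ λ^{(1-2α)(n₀+k)}`; this is the dyadic counterpart of Tao's remark that the blow-up
of Thm. 1.5 is of Type II (critical norms diverge), so arguments excluding only Type-I blow-up
do not address this barrier. [cite: Tao2016AveragedNS, §5.2 Prop. 5.1] [cite: Tao2016AveragedNS, §1.1 footnote p. 8] -/
theorem TruncatedDyadicBlowup.critical_blowup (h : TruncatedDyadicBlowup) {lam α : ℝ}
    (hlam : 1 < lam) (hα : 0 < α) (hα' : α < 1 / 2) :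
    ∃ (n₀ : ℕ) (t : ℕ → ℝ) (Tstar : ℝ) (X : ℕ → ℝ → ℝ),
      t 0 = 0 ∧ StrictMono t ∧ (∀ k, t k < Tstar) ∧ Tendsto t atTop (𝓝 Tstar) ∧
      (∀ k, ContinuousOn (X k) (Ico 0 Tstar)) ∧
      (∀ k, ∀ s ∈ Ico 0 Tstar, s ∉ range t →
        HasDerivAt (X k) (TruncatedDyadic.truncRHS lam α n₀ t X k s) s) ∧
      ∀ M s₀ : ℝ, s₀ < Tstar →
        ∃ s ∈ Ioo s₀ Tstar, ∃ k : ℕ, M < lam ^ ((1 - 2 * α) * ((n₀ + k : ℕ) : ℝ)) * |X k s| := by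
  obtain ⟨n₀, t, Tstar, X, h0, hmono, hlt, hlim, hcont, -, hode, -, hblow⟩ :=
    h lam α ((1 - 2 * α) / 2) hlam hα hα' (by linarith) (by linarith)
  refine ⟨n₀, t, Tstar, X, h0, hmono, hlt, hlim, hcont, hode, fun M s₀ hs₀ => ?_⟩
  obtain ⟨s, hs, k, hk⟩ := hblow (3 * (1 - 2 * α) / 4) (by linarith) M s₀ hs₀
  refine ⟨s, hs, k, hk.trans_le (mul_le_mul_of_nonneg_right ?_ (abs_nonneg _))⟩
  exact Real.rpow_le_rpow_of_exponent_le hlam.le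
    (mul_le_mul_of_nonneg_right (by linarith) (Nat.cast_nonneg _))

end Literature.Barriers.NavierStokesRegularity
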